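import Mathlib.Analysis.InnerProductSpace.GramSchmidtOrtho
import Mathlib.MeasureTheory.Function.SpecialFunctions.Inner
import Mathlib.MeasureTheory.Constructions.BorelSpace.Metric
import Mathlib.Data.Fintype.Fin
import HarnessLib

/-!
# Gram–Schmidt: equivariance, restriction, projection form, measurability

`Literature/Analysis/InnerProduct/`. Complements to Mathlib's `InnerProductSpace.gramSchmidt` /
`gramSchmidtNormed` needed to realise the first columns of a Haar unitary as the Gram–Schmidt
orthonormalisation of independent Gaussian vectors:

* `gramSchmidt_map_linearIsometry`, `gramSchmidtNormed_map_linearIsometry` — equivariance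
  under linear isometries: `GS (U ∘ v) = U ∘ GS v`;
* `gramSchmidt_comp_castSucc`, `gramSchmidtNormed_comp_castSucc` — the first `q` outputs only
  depend on the first `q` inputs;
* `gramSchmidt_eq_sub_starProjection` — `GS v n = v n - P_{span (v '' Iio n)} (v n)`, the
  residual of the orthogonal projection onto the span of the previous vectors (Mathlib defines
  `GS v n` as `v n` minus the *sum of the projections onto the lines* `𝕜 ∙ GS v i`, `i < n`);
  in particular `gramSchmidt_last_eq_sub_starProjection` for `Fin (q + 1)`;
* `measurable_gramSchmidt`, `measurable_gramSchmidtNormed` — measurability of `v ↦ GS v` on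
  `ι → E`.

All [folklore].
-/

noncomputable section

open Finset Submodule Module InnerProductSpace MeasureTheory
open scoped InnerProductSpace

namespace Literature.Analysis.InnerProduct

variable (𝕜 : Type*) {E E' : Type*} [RCLike 𝕜] [NormedAddCommGroup E] [InnerProductSpace 𝕜 E]
  [NormedAddCommGroup E'] [InnerProductSpace 𝕜 E']
variable {ι : Type*} [LinearOrder ι] [LocallyFiniteOrderBot ι] [WellFoundedLT ι]

/-! ### Equivariance under linear isometries -/

/-- **Gram–Schmidt commutes with linear isometries**: `GS (U ∘ v) n = U (GS v n)` (inner
products and norms, hence all the projections in the recursion, are preserved). [folklore] -/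
theorem gramSchmidt_map_linearIsometry (U : E →ₗᵢ[𝕜] E') (v : ι → E) (n : ι) :
    gramSchmidt 𝕜 (U ∘ v) n = U (gramSchmidt 𝕜 v n) := by
  refine WellFounded.induction (C := fun n => gramSchmidt 𝕜 (U ∘ v) n = U (gramSchmidt 𝕜 v n))
    wellFounded_lt n (fun n ih => ?_)
  rw [gramSchmidt_def, gramSchmidt_def 𝕜 v n, map_sub, map_sum]
  congr 1
  refine Finset.sum_congr rfl fun i hi => ?_
  rw [Function.comp_apply, ih i (Finset.mem_Iio.1 hi), starProjection_singleton,
    starProjection_singleton, U.inner_map_map, U.norm_map, LinearIsometry.map_smul]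

/-- The normalised Gram–Schmidt vectors are equivariant as well:
`GSN (U ∘ v) n = U (GSN v n)`. [folklore] -/
theorem gramSchmidtNormed_map_linearIsometry (U : E →ₗᵢ[𝕜] E') (v : ι → E) (n : ι) :
    gramSchmidtNormed 𝕜 (U ∘ v) n = U (gramSchmidtNormed 𝕜 v n) := by
  rw [gramSchmidtNormed, gramSchmidtNormed, gramSchmidt_map_linearIsometry, U.norm_map,
    LinearIsometry.map_smul]

/-! ### Restriction to an initial segment -/

/-- **Gram–Schmidt is sequential**: the outputs with index below `q` only depend on the inputs
with index below `q` — `GS (v ∘ castSucc) i = GS v (castSucc i)`. [folklore] -/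
theorem gramSchmidt_comp_castSucc {q : ℕ} (v : Fin (q + 1) → E) (i : Fin q) :
    gramSchmidt 𝕜 (v ∘ Fin.castSucc) i = gramSchmidt 𝕜 v (Fin.castSucc i) := by
  refine WellFounded.induction
    (C := fun i => gramSchmidt 𝕜 (v ∘ Fin.castSucc) i = gramSchmidt 𝕜 v (Fin.castSucc i))
    wellFounded_lt i (fun i ih => ?_)
  rw [gramSchmidt_def, gramSchmidt_def 𝕜 v (Fin.castSucc i), Fin.Iio_castSucc, Finset.sum_map]
  congr 1
  refine Finset.sum_congr rfl fun j hj => ?_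
  rw [ih j (Finset.mem_Iio.1 hj)]
  rfl

/-- Normalised version of `gramSchmidt_comp_castSucc`. [folklore] -/
theorem gramSchmidtNormed_comp_castSucc {q : ℕ} (v : Fin (q + 1) → E) (i : Fin q) :
    gramSchmidtNormed 𝕜 (v ∘ Fin.castSucc) i = gramSchmidtNormed 𝕜 v (Fin.castSucc i) := by
  rw [gramSchmidtNormed, gramSchmidtNormed, gramSchmidt_comp_castSucc]

/-! ### Projection form -/

/-- The sum of the projections onto the pairwise orthogonal lines `𝕜 ∙ GS v i`, `i < n`, is the
orthogonal projection onto their span. [folklore] -/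
theorem sum_starProjection_gramSchmidt_eq [FiniteDimensional 𝕜 E] (v : ι → E) (n : ι) (x : E) :
    ∑ i ∈ Iio n, (𝕜 ∙ gramSchmidt 𝕜 v i).starProjection x =
      (span 𝕜 (gramSchmidt 𝕜 v '' Set.Iio n)).starProjection x := by
  symm
  refine eq_starProjection_of_mem_of_inner_eq_zero ?_ ?_
  · refine Submodule.sum_mem _ fun i hi => ?_
    rw [starProjection_singleton]
    exact Submodule.smul_mem _ _ (subset_span ⟨i, Finset.mem_Iio.1 hi, rfl⟩)
  · -- orthogonality to the generators suffices
    have key : ∀ j ∈ Iio n, ⟪x - ∑ i ∈ Iio n, (𝕜 ∙ gramSchmidt 𝕜 v i).starProjection x,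
        gramSchmidt 𝕜 v j⟫_𝕜 = 0 := by
      intro j hj
      rw [inner_sub_left, sum_inner, Finset.sum_eq_single_of_mem j hj]
      · rw [starProjection_singleton, inner_smul_left]
        by_cases h0 : gramSchmidt 𝕜 v j = 0
        · simp [h0]
        · have hne : ((‖gramSchmidt 𝕜 v j‖ : 𝕜)) ^ 2 ≠ 0 :=
            pow_ne_zero 2 (by exact_mod_cast norm_ne_zero_iff.2 h0)
          rw [map_div₀, RCLike.conj_ofReal, inner_conj_symm, RCLike.ofReal_pow,
            inner_self_eq_norm_sq_to_K, div_mul_cancel₀ _ hne, sub_self]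
      · intro i _ hij
        rw [starProjection_singleton, inner_smul_left, gramSchmidt_orthogonal 𝕜 v hij, mul_zero]
    intro w hw
    have hsub : gramSchmidt 𝕜 v '' Set.Iio n ⊆
        (𝕜 ∙ (x - ∑ i ∈ Iio n, (𝕜 ∙ gramSchmidt 𝕜 v i).starProjection x))ᗮ := by
      rintro _ ⟨j, hj, rfl⟩
      exact mem_orthogonal_singleton_iff_inner_right.2 (key j (Finset.mem_Iio.2 hj))
    exact mem_orthogonal_singleton_iff_inner_right.1 (span_le.2 hsub hw)

/-- **Gram–Schmidt as a residual**: `GS v n = v n - P (v n)`, `P` the orthogonal projection onto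
the span of the previous vectors `v i`, `i < n` (equivalently of the previous outputs).
[folklore] -/
theorem gramSchmidt_eq_sub_starProjection [FiniteDimensional 𝕜 E] (v : ι → E) (n : ι) :
    gramSchmidt 𝕜 v n = v n - (span 𝕜 (v '' Set.Iio n)).starProjection (v n) := by
  rw [gramSchmidt_def, sum_starProjection_gramSchmidt_eq, span_gramSchmidt_Iio]

/-- The last Gram–Schmidt vector of a family indexed by `Fin (q + 1)` is the residual of the
projection of the last vector onto the span of the first `q`. [folklore] -/
theorem gramSchmidt_last_eq_sub_starProjection [FiniteDimensional 𝕜 E] {q : ℕ}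
    (v : Fin (q + 1) → E) :
    gramSchmidt 𝕜 v (Fin.last q) =
      v (Fin.last q) - (span 𝕜 (Set.range (v ∘ Fin.castSucc))).starProjection (v (Fin.last q)) := by
  rw [gramSchmidt_eq_sub_starProjection, Set.range_comp, Fin.range_castSucc]
  rfl

/-! ### Measurability -/

variable [MeasurableSpace E] [BorelSpace E] [SecondCountableTopology E]

/-- `v ↦ GS v n` is measurable on `ι → E`: a finite recursion of inner products,
norms, divisions and linear combinations. [folklore] -/
@[fun_prop]
theorem measurable_gramSchmidt_apply (n : ι) : Measurable fun v : ι → E => gramSchmidt 𝕜 v n := by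
  refine WellFounded.induction (C := fun n => Measurable fun v : ι → E => gramSchmidt 𝕜 v n)
    wellFounded_lt n (fun n ih => ?_)
  have h : (fun v : ι → E => gramSchmidt 𝕜 v n) = fun v => v n - ∑ i ∈ Iio n,
      (⟪gramSchmidt 𝕜 v i, v n⟫_𝕜 / ((‖gramSchmidt 𝕜 v i‖ ^ 2 : ℝ) : 𝕜)) • gramSchmidt 𝕜 v i := by
    funext v
    rw [gramSchmidt_def]
    simp_rw [starProjection_singleton]
  rw [h]
  refine (measurable_pi_apply n).sub (Finset.measurable_sum _ fun i hi => ?_)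
  have hi' := ih i (Finset.mem_Iio.1 hi)
  refine Measurable.smul (Measurable.div (hi'.inner (measurable_pi_apply n)) ?_) hi'
  exact RCLike.continuous_ofReal.measurable.comp (hi'.norm.pow_const 2)

/-- `v ↦ GS v` is measurable. [folklore] -/
@[fun_prop]
theorem measurable_gramSchmidt : Measurable (gramSchmidt 𝕜 : (ι → E) → ι → E) :=
  measurable_pi_lambda _ fun n => measurable_gramSchmidt_apply 𝕜 n

/-- `v ↦ GSN v n` is measurable. [folklore] -/
@[fun_prop]
theorem measurable_gramSchmidtNormed_apply (n : ι) :
    Measurable fun v : ι → E => gramSchmidtNormed 𝕜 v n := by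
  unfold gramSchmidtNormed
  have h1 : Measurable fun v : ι → E => ‖gramSchmidt 𝕜 v n‖ :=
    (measurable_gramSchmidt_apply 𝕜 n).norm
  have h2 : Measurable fun v : ι → E => ((‖gramSchmidt 𝕜 v n‖ : ℝ) : 𝕜) :=
    RCLike.continuous_ofReal.measurable.comp h1
  exact h2.inv.smul (measurable_gramSchmidt_apply 𝕜 n)

/-- `v ↦ GSN v` is measurable. [folklore] -/
@[fun_prop]
theorem measurable_gramSchmidtNormed : Measurable (gramSchmidtNormed 𝕜 : (ι → E) → ι → E) :=
  measurable_pi_lambda _ fun n => measurable_gramSchmidtNormed_apply 𝕜 n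

end Literature.Analysis.InnerProduct
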